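import Summits.AnomalousDissipation.AnomalousDissipation.Theorems.RelaxingFamily.Negative.LinearEnstrophyBudget
import Literature.Analysis.FluidPDE.LerayHopfUniformEnergyMomentum
import Literature.Analysis.FluidPDE.LerayHopfTranslate
import Literature.Analysis.FluidPDE.AlexakisDoeringInterpolation
import HarnessLib

/-!
# Negative knowledge for the crux `RelaxingFamily` (stmt-AnomalousDissipation-15009), II: the energy
# clause is automatic; finite total enstrophy and unforced families are excluded

Refuted strengthenings (`_false_without_` shape, cdisprove seat) of
`Summit.AnomalousDissipation.AnomalousDissipation.Theses.LimitingAbsorption.RelaxingFamily` (route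
`route-AnomalousDissipation-LimitingAbsorption`, crux r3; supports stmt-AnomalousDissipation-15009),
continuing `Negative/LinearEnstrophyBudget.lean` (the Seis floor: `¬ RelaxingFamilyUnder
LinearEnstrophyBudget`, `¬ RelaxingFamilyUnder QuadraticEnstrophyBudget`):

* `exists_lintegral_translate_le` — for the forces the crux admits (steady, smooth, MEAN-ZERO) every
  global planar Leray–Hopf solution with `ν > 0` has essentially bounded energy from every phase
  (FMRT 2001, (3.2), in tree: `Torus.IsGlobalLerayHopf.exists_forall_integral_norm_sq_le_of_hasZeroMean`),
  so the energy conjunct of the budget classes is free: `LinearEnstrophyBudget₀`,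
  `QuadraticEnstrophyBudget₀` are the budget-only classes and
  `relaxingFamily_false_without_superlinearEnstrophy₀`,
  `relaxingFamily_false_without_superlinearMeanEnstrophy₀` their exclusions.
* `FiniteEnstrophyDissipation` — every level dissipates a FINITE total enstrophy,
  `∫₀^∞ ‖∇v_j‖₂² < ∞` (no uniformity in `j` asked): a late phase then carries a unit window budget
  (`exists_phase_window_le_of_lintegral_ne_top`), whence
  `relaxingFamily_false_without_infiniteEnstrophyDissipation : ¬ RelaxingFamilyUnder
  FiniteEnstrophyDissipation` — a witness must dissipate an infinite total enstrophy at all but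
  finitely many levels' worth of the argument (here: at some level).
* `relaxingFamily_false_without_forcing : ¬ RelaxingFamilyUnder (fun g _ _ _ => g = 0)` — the
  signature of the crux admits `g = 0`; unforced Leray–Hopf families have
  `∫₀^∞ ‖∇v_j‖₂² ≤ ‖v_j(0)‖₂²/(2ν_j)` (Leray's energy inequality), so they are no witnesses: any proof
  of `RelaxingFamily` must use a nonzero force (the late phases of a decaying flow relax `h` only at
  the heat rate).

## References

* C. Foias, O. Manley, R. Rosa, R. Temam, *Navier–Stokes Equations and Turbulence*, CUP 2001,
  Ch. IV §3.1 (3.2). [`FMRT2001`]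
* J. Leray, Acta Math. 63 (1934), §III (5.2) (energy inequality). [`Leray1934`]
* C. Seis, Comm. Math. Phys. 399 (2023) = arXiv:2003.08794, Thm. 2, Rmk. 1. [`Seis2022`]
-/

noncomputable section

open MeasureTheory Set Filter Function TopologicalSpace Topology
open scoped ENNReal NNReal InnerProductSpace

namespace Summit.AnomalousDissipation.AnomalousDissipation.Theorems.RelaxingFamily.Negative

-- D-0017: single-problem summit ⇒ `Summit.AnomalousDissipation.AnomalousDissipation.…` by design.
set_option linter.dupNamespace false

open Literature.Analysis.FunctionSpaces Literature.Analysis.FunctionSpaces.Torus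
open Literature.Analysis.FluidPDE Literature.Analysis.FluidPDE.Torus
open Summit.AnomalousDissipation.AnomalousDissipation.Theses.LimitingAbsorption

/-- The unit flat 2-torus (local notation). -/
local notation "𝕋²" => UnitAddTorus (Fin 2)
/-- Planar vectors (local notation). -/
local notation "E²" => EuclideanSpace ℝ (Fin 2)

/-! ## The energy clause is automatic for the crux's forces -/

/-- **Ess-bounded energy from every phase** (FMRT 2001 (3.2)): a global Leray–Hopf solution of the
planar Navier–Stokes equations with `ν > 0` and a steady smooth mean-zero force has
`∫ |v(s + t)|² ≤ M'` for every phase `s ≥ 0` and every `t > 0`. This is the energy conjunct of the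
budget classes `LinearEnstrophyBudget` / `QuadraticEnstrophyBudget`, which is therefore free for every
family admitted by the crux `RelaxingFamily`. [cite: FMRT2001, Ch. IV §3.1 (3.2)] -/
theorem exists_lintegral_translate_le {ν : ℝ} {g : 𝕋² → E²} {v₀ : 𝕋² → E²} {v : ℝ → 𝕋² → E²}
    (hν : 0 < ν) (hg : IsSmooth g) (hgm : HasZeroMean g)
    (hv : IsGlobalLerayHopf ν (fun _ => g) v₀ v) {s : ℝ} (hs : 0 ≤ s) :
    ∃ M' : ℝ≥0, ∀ᵐ t ∂(volume.restrict (Ioi (0 : ℝ))), ∫⁻ x, ‖v (s + t) x‖ₑ ^ 2 ≤ M' := by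
  obtain ⟨R, hR⟩ := hv.exists_forall_integral_norm_sq_le_of_hasZeroMean hν (hg.memLp 2) hgm
  refine ⟨R.toNNReal, (ae_restrict_mem measurableSet_Ioi).mono fun t ht => ?_⟩
  have hst : 0 ≤ s + t := by have := mem_Ioi.1 ht; linarith
  rw [Literature.Analysis.FluidPDE.lintegral_enorm_sq_eq_ofReal (hv.memLp_two hst)]
  exact ENNReal.ofReal_le_ofReal (hR _ hst)

/-- **Linear windowed budget, energy clause dropped**: one slope `M ≥ 0` such that every level `j` has a
phase `s_j ≥ 0` with `∫₀ᵗ ‖∇v_j(s_j + τ)‖_{L²} dτ ≤ M (1 + t)` for all `t > 0`. -/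
def LinearEnstrophyBudget₀ (_g : 𝕋² → E²) (_h : 𝕋² → ℝ) (_ν : ℕ → ℝ) (v : ℕ → ℝ → 𝕋² → E²) : Prop :=
  ∃ M : ℝ, 0 ≤ M ∧ ∀ j : ℕ, ∃ s : ℝ, 0 ≤ s ∧ ∀ t : ℝ, 0 < t →
    ∫⁻ τ in Ioo 0 t, eGradNormSq (v j (s + τ)) ^ (1 / 2 : ℝ) ≤ ENNReal.ofReal (M * (1 + t))

/-- **Quadratic windowed budget, energy clause dropped**: one `Z ≥ 0` such that every level `j` has a
phase `s_j ≥ 0` with `∫₀ᵗ ‖∇v_j(s_j + τ)‖²_{L²} dτ ≤ Z (1 + t)` for all `t > 0`. -/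
def QuadraticEnstrophyBudget₀ (_g : 𝕋² → E²) (_h : 𝕋² → ℝ) (_ν : ℕ → ℝ)
    (v : ℕ → ℝ → 𝕋² → E²) : Prop :=
  ∃ Z : ℝ, 0 ≤ Z ∧ ∀ j : ℕ, ∃ s : ℝ, 0 ≤ s ∧ ∀ t : ℝ, 0 < t →
    ∫⁻ τ in Ioo 0 t, eGradNormSq (v j (s + τ)) ≤ ENNReal.ofReal (Z * (1 + t))

/-- **`RelaxingFamily` is false without super-linear enstrophy growth — budget-only form**
(the energy clause of `LinearEnstrophyBudget` is supplied by `exists_lintegral_translate_le`).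
[cite: Seis2022, Remark 1 (arXiv:2003.08794 p. 4)] -/
theorem relaxingFamily_false_without_superlinearEnstrophy₀ :
    ¬ RelaxingFamilyUnder LinearEnstrophyBudget₀ := by
  rintro ⟨g, h, hg, hgd, hgm, hh, hhm, hh0, ν, v₀, v, hν, hνlim, hLH, hbd, hE, ⟨M, hM, hb⟩, hrest⟩
  refine relaxingFamily_false_without_superlinearEnstrophy
    ⟨g, h, hg, hgd, hgm, hh, hhm, hh0, ν, v₀, v, hν, hνlim, hLH, hbd, hE, ⟨M, hM, fun j => ?_⟩, hrest⟩
  obtain ⟨s, hs, hbud⟩ := hb j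
  exact ⟨s, hs, exists_lintegral_translate_le (hν j) hg hgm (hLH j) hs, hbud⟩

/-- **`RelaxingFamily` is false without super-linear growth of the windowed mean enstrophy —
budget-only form** (the energy clause of `QuadraticEnstrophyBudget` is supplied by
`exists_lintegral_translate_le`). [cite: Seis2022, Remark 1 (arXiv:2003.08794 p. 4)] -/
theorem relaxingFamily_false_without_superlinearMeanEnstrophy₀ :
    ¬ RelaxingFamilyUnder QuadraticEnstrophyBudget₀ := by
  rintro ⟨g, h, hg, hgd, hgm, hh, hhm, hh0, ν, v₀, v, hν, hνlim, hLH, hbd, hE, ⟨Z, hZ, hb⟩, hrest⟩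
  refine relaxingFamily_false_without_superlinearMeanEnstrophy
    ⟨g, h, hg, hgd, hgm, hh, hhm, hh0, ν, v₀, v, hν, hνlim, hLH, hbd, hE, ⟨Z, hZ, fun j => ?_⟩, hrest⟩
  obtain ⟨s, hs, hbud⟩ := hb j
  exact ⟨s, hs, exists_lintegral_translate_le (hν j) hg hgm (hLH j) hs, hbud⟩

/-! ## Tails of a finite enstrophy integral -/

/-- If `∫_{(0,∞)} Z < ∞` then some tail `∫_{(n,∞)} Z` is at most `1` (exhaustion by `(0, n]` and
monotone convergence). [folklore] -/
theorem exists_lintegral_Ioi_nat_le_one {Z : ℝ → ℝ≥0∞} (hfin : ∫⁻ t in Ioi (0 : ℝ), Z t ≠ ⊤) :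
    ∃ n : ℕ, ∫⁻ t in Ioi (n : ℝ), Z t ≤ 1 := by
  set I : ℝ≥0∞ := ∫⁻ t in Ioi (0 : ℝ), Z t with hI
  set a : ℕ → ℝ≥0∞ := fun n => ∫⁻ t in Ioc (0 : ℝ) n, Z t with ha
  have hmono : Monotone fun n : ℕ => Ioc (0 : ℝ) n := fun m n hmn =>
    Ioc_subset_Ioc_right (by exact_mod_cast hmn)
  have hU : (⋃ n : ℕ, Ioc (0 : ℝ) n) = Ioi 0 := by
    ext t
    simp only [mem_iUnion, mem_Ioc, mem_Ioi]
    constructor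
    · rintro ⟨n, h1, -⟩; exact h1
    · intro ht
      obtain ⟨n, hn⟩ := exists_nat_ge t
      exact ⟨n, ht, hn⟩
  have hIsup : I = ⨆ n : ℕ, a n := by
    rw [hI, ← hU, setLIntegral_iUnion_of_directed _ hmono.directed_le]
  have hamono : Monotone a := fun m n h => lintegral_mono_set (hmono h)
  have htend : Tendsto a atTop (𝓝 I) := by
    rw [hIsup]; exact tendsto_atTop_iSup hamono
  obtain ⟨N, hN⟩ := (ENNReal.tendsto_atTop hfin).1 htend 1 one_pos
  have hN1 : I ≤ a N + 1 := tsub_le_iff_right.1 (hN N le_rfl).1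
  refine ⟨N, ?_⟩
  have hsplit : I = a N + ∫⁻ t in Ioi (N : ℝ), Z t := by
    have hdisj : Disjoint (Ioc (0 : ℝ) N) (Ioi N) := by
      rw [Set.disjoint_left]
      rintro t ⟨-, h1⟩ h2
      exact absurd (mem_Ioi.1 h2) (not_lt.2 h1)
    have hun : Ioc (0 : ℝ) N ∪ Ioi N = Ioi 0 := by
      ext t
      simp only [mem_union, mem_Ioc, mem_Ioi]
      constructor
      · rintro (⟨h1, -⟩ | h1)
        · exact h1
        · exact lt_of_le_of_lt (Nat.cast_nonneg N) h1
      · intro ht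
        rcases le_or_gt t N with h | h
        · exact Or.inl ⟨ht, h⟩
        · exact Or.inr h
    rw [hI, ← hun, lintegral_union measurableSet_Ioi hdisj]
  have haN : a N ≠ ⊤ := by
    refine ne_top_of_le_ne_top hfin ?_
    exact lintegral_mono_set (fun t ht => (ht.1 : 0 < t))
  rw [hsplit] at hN1
  exact (ENNReal.add_le_add_iff_left haN).1 hN1

/-- **A late phase with unit budget.** If `∫_{(0,∞)} Z < ∞` then from some phase `s ≥ 0` on every
window carries at most `1`: `∫_{(0,t)} Z(s + τ) dτ ≤ 1 ≤ 1 · (1 + t)`. [folklore] -/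
theorem exists_phase_window_le_of_lintegral_ne_top {Z : ℝ → ℝ≥0∞}
    (hfin : ∫⁻ t in Ioi (0 : ℝ), Z t ≠ ⊤) :
    ∃ s : ℝ, 0 ≤ s ∧ ∀ t : ℝ, 0 < t →
      ∫⁻ τ in Ioo 0 t, Z (s + τ) ≤ ENNReal.ofReal (1 * (1 + t)) := by
  obtain ⟨n, hn⟩ := exists_lintegral_Ioi_nat_le_one hfin
  refine ⟨n, Nat.cast_nonneg n, fun t ht => ?_⟩
  have e : (fun τ => Z ((n : ℝ) + τ)) = fun τ => Z (τ + n) := by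
    funext τ; rw [add_comm]
  calc ∫⁻ τ in Ioo 0 t, Z ((n : ℝ) + τ) = ∫⁻ τ in Ioo 0 t, Z (τ + n) := by rw [e]
    _ = ∫⁻ τ in Ioo (0 + (n : ℝ)) (t + n), Z τ := setLIntegral_Ioo_comp_add_right Z 0 t n
    _ ≤ ∫⁻ τ in Ioi (n : ℝ), Z τ := lintegral_mono_set fun τ hτ => by
        have := hτ.1; rw [zero_add] at this; exact this
    _ ≤ 1 := hn
    _ ≤ ENNReal.ofReal (1 * (1 + t)) := by
        rw [one_mul, ← ENNReal.ofReal_one]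
        exact ENNReal.ofReal_le_ofReal (by linarith)

/-! ## The excluded class: finite total enstrophy at every level -/

/-- **Finite total enstrophy dissipation**: at every level the Leray–Hopf trajectory has
`∫_{(0,∞)} ‖∇v_j(t)‖²_{L²} dt < ∞` — NO uniformity in `j` is asked (the budget is met with slope `1`
from a late, `j`-dependent phase). Unforced families land here; for a nonzero steady mean-zero force
the class is a degenerate corner (the flow must stop absorbing enstrophy from the force). -/
def FiniteEnstrophyDissipation (_g : 𝕋² → E²) (_h : 𝕋² → ℝ) (_ν : ℕ → ℝ)
    (v : ℕ → ℝ → 𝕋² → E²) : Prop :=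
  ∀ j : ℕ, ∫⁻ t in Ioi (0 : ℝ), eGradNormSq (v j t) ≠ ⊤

/-- **`RelaxingFamily` is false without infinite total enstrophy dissipation** (unconditional): no
witness of the crux has `∫₀^∞ ‖∇v_j‖₂² < ∞` at every level — from a late phase the windowed enstrophy
budget is `≤ 1`, the energy clause is automatic, and the Seis floor
(`relaxingFamily_false_without_superlinearMeanEnstrophy`) applies with `Z = 1`.
[cite: Seis2022, Remark 1 (arXiv:2003.08794 p. 4)] -/
theorem relaxingFamily_false_without_infiniteEnstrophyDissipation :
    ¬ RelaxingFamilyUnder FiniteEnstrophyDissipation := by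
  intro hF
  refine relaxingFamily_false_without_superlinearMeanEnstrophy₀ (hF.mono fun g h ν v hfin => ?_)
  refine ⟨1, zero_le_one, fun j => ?_⟩
  obtain ⟨s, hs, hbud⟩ := exists_phase_window_le_of_lintegral_ne_top (hfin j)
  exact ⟨s, hs, hbud⟩

/-! ## Unforced families -/

/-- **Unforced Leray–Hopf solutions have finite total enstrophy**: for `g = 0` and `ν > 0`,
`∫_{(0,∞)} ‖∇v‖₂² ≤ ½‖v₀‖₂²/ν < ∞` (Leray's energy inequality from `0` on every horizon, exhaustion
of `(0, ∞)` by the horizons). [cite: Leray1934, §III (5.2)] -/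
theorem lintegral_Ioi_eGradNormSq_ne_top_of_unforced {ν : ℝ} {v₀ : 𝕋² → E²} {v : ℝ → 𝕋² → E²}
    (hν : 0 < ν) (hv : IsGlobalLerayHopf ν (fun _ => (0 : 𝕋² → E²)) v₀ v) :
    ∫⁻ t in Ioi (0 : ℝ), eGradNormSq (v t) ≠ ⊤ := by
  set K : ℝ := kineticEnergy v₀ / ν with hK
  have hT : ∀ T : ℝ, 0 < T → ∫⁻ t in Ioo 0 T, eGradNormSq (v t) ≤ ENNReal.ofReal K := by
    intro T hT
    have hLH := hv T hT
    have hE := hLH.energy_ineq_zero T ⟨hT.le, le_rfl⟩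
    have hforce : ∫ τ in (0 : ℝ)..T, ∫ x, ⟪(fun _ : ℝ => (0 : 𝕋² → E²)) τ x, v τ x⟫_ℝ = 0 := by
      simp
    rw [hforce, add_zero] at hE
    have hkin : 0 ≤ kineticEnergy (v T) := kineticEnergy_nonneg _
    have hfin : ∫⁻ t in Ioo 0 T, eGradNormSq (v t) ≠ ⊤ := hLH.lintegral_eGradNormSq_lt_top.ne
    have hK0 : 0 ≤ K := div_nonneg (kineticEnergy_nonneg _) hν.le
    rw [ENNReal.le_ofReal_iff_toReal_le hfin hK0, hK, le_div_iff₀ hν]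
    nlinarith
  have hmono : Monotone fun n : ℕ => Ioo (0 : ℝ) n := fun m n hmn =>
    Ioo_subset_Ioo_right (by exact_mod_cast hmn)
  have hU : (⋃ n : ℕ, Ioo (0 : ℝ) n) = Ioi 0 := by
    ext t
    simp only [mem_iUnion, mem_Ioo, mem_Ioi]
    constructor
    · rintro ⟨n, h1, -⟩; exact h1
    · intro ht
      obtain ⟨n, hn⟩ := exists_nat_gt t
      exact ⟨n, ht, hn⟩
  have hle : ∫⁻ t in Ioi (0 : ℝ), eGradNormSq (v t) ≤ ENNReal.ofReal K := by
    rw [← hU, setLIntegral_iUnion_of_directed _ hmono.directed_le]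
    refine iSup_le fun n => ?_
    rcases Nat.eq_zero_or_pos n with h0 | hpos
    · subst h0; simp
    · exact hT n (by exact_mod_cast hpos)
  exact ne_top_of_le_ne_top ENNReal.ofReal_ne_top hle

/-- **`RelaxingFamily` is false without forcing** (unconditional; the crux's signature admits
`g = 0`): no witness of the crux is unforced — unforced families dissipate a finite total enstrophy
at every level (`lintegral_Ioi_eGradNormSq_ne_top_of_unforced`), which
`relaxingFamily_false_without_infiniteEnstrophyDissipation` excludes. Any proof of `RelaxingFamily`
must use `g ≠ 0`. [cite: Seis2022, Remark 1 (arXiv:2003.08794 p. 4)] -/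
theorem relaxingFamily_false_without_forcing :
    ¬ RelaxingFamilyUnder (fun g _ _ _ => g = 0) := by
  rintro ⟨g, h, hg, hgd, hgm, hh, hhm, hh0, ν, v₀, v, hν, hνlim, hLH, hbd, hE, hg0, hrest⟩
  subst hg0
  exact relaxingFamily_false_without_infiniteEnstrophyDissipation
    ⟨0, h, hg, hgd, hgm, hh, hhm, hh0, ν, v₀, v, hν, hνlim, hLH, hbd, hE,
      fun j => lintegral_Ioi_eGradNormSq_ne_top_of_unforced (hν j) (hLH j), hrest⟩

end Summit.AnomalousDissipation.AnomalousDissipation.Theorems.RelaxingFamily.Negative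

end
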